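import Mathlib
import HarnessLib
import HarnessLib.Audit
import Summits.AtomisticToContinuum.Statement
import Literature.MathematicalPhysics.QuantumLattice.HeisenbergModel
import Literature.Probability.LatticeModels.LatticeGraph
import Literature.MathematicalPhysics.QuantumManyBody.PeriodicBoseGas
import HarnessLib.Audit.Status.Attr

/-!
Route: BECFillingDescent

# Route BECFillingDescent — descend the number sectors from the reflection-positive rung — KLS
anchor × monotone condensate fraction ⇒ uniform dilute lattice BEC ⇒ depth bridge at spacing ≥ 4R₀

It suffices to show X = UniformDiluteLatticeBEC (target) together with the two transfer cruxes
DiluteLatticeBridge and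
BoundaryTransferWeak (card kls-anchor-filling-monotone, spine; D-0027-conforming re-filing of the
retired
route-AtomisticToContinuum-BECFillingMonotone with a PROVED pure-logic `closes`). X (T = 0, d = 3,
the dilute half of LSSY's open
"BEC at other fillings"): there are ν₀, c > 0 and L₀ such that on every even torus (ℤ/Lℤ)³, L ≥ L₀,
for every particle number
1 ≤ N ≤ ν₀L³, every ground vector ψ of the spin-½ XY ferromagnet `xyTorus 3 L 1` (= hard-core
bosons, a†_x = S⁺_x) in the
magnetisation sector S³_tot = N − L³/2 (unit vector of `spinZSector`, eigenvalue
`lowestEnergyInSector`) has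
⟨ψ, S⁺_tot S⁻_tot ψ⟩ = Σ_{x,y}⟨a†_x a_y⟩ = L³·(zero-mode occupation) ≥ c·N·L³ — condensate fraction
≥ c UNIFORMLY in the filling
ν = N/L³ ≤ ν₀. X follows by LatticeGlue (support, proved in Sketch.lean) from the KLS anchor
AnchorSectorBEC (support, provable from the
tree's `kennedy_lieb_shastry_xy_ground_holds`) and ONE sector-comparison crux, FractionMonotone
(card conjecture M).
Lean: `∃ ν₀ : ℝ, 0 < ν₀ ∧ ∃ c : ℝ, 0 < c ∧ ∃ L₀ : ℕ, ∀ (L : ℕ) [NeZero L], L₀ ≤ L → Even L → ∀ N :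
ℕ, 1 ≤ N → (N : ℝ) ≤ ν₀ * (L : ℝ) ^ 3 → ∀ ψ :
Literature.MathematicalPhysics.QuantumLattice.TensorIndex
(Literature.Probability.LatticeModels.TorusSite 3 L) 2 → ℂ, ψ ∈
Literature.MathematicalPhysics.QuantumLattice.spinZSector (Λ :=
Literature.Probability.LatticeModels.TorusSite 3 L) 1 ((N : ℝ) - (L : ℝ) ^ 3 / 2) → star ψ ⬝ᵥ ψ = 1
→ (Literature.MathematicalPhysics.QuantumLattice.xyTorus 3 L 1) *ᵥ ψ =
((Literature.MathematicalPhysics.QuantumLattice.lowestEnergyInSector 1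
(Literature.MathematicalPhysics.QuantumLattice.xyTorus 3 L 1) ((N : ℝ) - (L : ℝ) ^ 3 / 2) : ℝ) : ℂ)
• ψ → c * N * (L : ℝ) ^ 3 ≤ (star ψ ⬝ᵥ (((Literature.MathematicalPhysics.QuantumLattice.totalSpin 1
0 + Complex.I • Literature.MathematicalPhysics.QuantumLattice.totalSpin 1 1) *
(Literature.MathematicalPhysics.QuantumLattice.totalSpin 1 0 - Complex.I •
Literature.MathematicalPhysics.QuantumLattice.totalSpin 1 1)) *ᵥ ψ)).re`

## Assembly
Pure logic, PROVED sorry-free in glue.lean / Sketch.lean: `theorem closes (hA : AnchorSectorBEC) (hM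
: FractionMonotone) (hG : LatticeGlue)
(hB : DiluteLatticeBridge) (hT : BoundaryTransferWeak) : BoseEinsteinCondensation := fun v hv => hT
v hv (hB (hG hM hA) v hv)` — hG hM hA is
the target X; the bridge turns X into PeriodicBEC(v), whose statement is syntactically the
antecedent of the shared transfer 0827, whose
conclusion is the v-clause of the sub-problem Statement decl `_root_.BoseEinsteinCondensation` (root
abbrev of
Literature.MathematicalPhysics.QuantumManyBody.BoseGas.BoseEinsteinCondensation). A direct proof of
the target replaces hG hM hA.

Rationale: WHY THIS LINE. The only interacting Bose system with a thermodynamic-limit condensation THEOREM is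
the hard-core lattice gas at the particle–hole
symmetric point (KLS1988PRL / AizenmanEtAl2004; in the tree, proved:
`kennedy_lieb_shastry_xy_ground_holds`), and LSSY2005 Ch. 11 §11.1
records that reflection positivity cannot leave it (tree lemma `rp_oddCharge_eq_zero`: an RP state
has ⟨N⟩ = |Λ|/2). This line keeps RP
where it is a theorem and moves in the conserved charge by ORDER: in each number sector the hopping
Hamiltonian is stoquastic with a unique
positive (Perron–Frobenius) ground state, and the card's conjecture M — the condensate fraction
f_L(N) = ⟨S⁺_totS⁻_tot⟩_N/(N·L³) is
non-increasing in N below half filling, "adding a hard-core boson can only deplete" (exact on the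
complete graph, f = 1 − (N−1)/V,
Toth1991 / doi:10.1007/BF01029210; consistent with Tóth's rigorous bound f ≤ 1 − ν + 1/V, spin-wave
theory and QMC doi:10.1103/PhysRevB.65.104519,
doi:10.1103/physrevb.53.5826) — carries the anchor from its (unknown) sector N* ∈ [c₁V, V/2] down to
every dilute filling; the
ordering-of-levels literature (LiebMattis1962, doi:10.1023/b:joss.0000037227.24460.e5) is the
template, for an order parameter instead of an
energy. Imported: comparison/positivity methods for stoquastic ground states (lattice half);
semiclassical tight-binding reduction plus ONE
one-body comparison sign for the continuum half (DiluteLatticeBridge: optical-lattice depth dial at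
FIXED spacing b ∈ [4R₀, 8R₀), whose deep
end is exactly the dilute hard-core lattice gas certified by X; weak-lattice end supported by the
Bogoliubov "potential depletion" δn⁽²⁾ ≥ 0
in d = 3 of arXiv:1202.3489, deep end by doi:10.1103/physrevlett.96.180405). Versus gen-1
(BECFillingMonotone, retired not-a-thesis): the
deciding theorem is now pure logic over the items; crux D (half filling maximises the planar moment)
is no longer needed (monotone form of M +
the trivial bound ⟨S⁺S⁻⟩ ≤ V·N locate the anchor); and the bridge spacing is corrected — with b =
2R₀ a hard-sphere v (a = R₀) has a/b = 0.5
above the hard-core lattice scattering length 0.316 b (arXiv:2112.10301; arXiv:2602.16566 eq.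
(2.12)), so "the lattice end is the more
depleted one" fails at leading LHY order, whereas b ≥ 4R₀ gives a/b ≤ 1/4 < 0.316 for every
admissible v. No open route uses the filling
axis (BECDensityChord: density chord from the FREE fixed-N endpoint; BECChargeConjugationRP:
relativistic C-point anchor; BECGroundStateSOS:
certificates off half filling); the negatives index has no lattice statement.

RANKED CRUXES. #0 UniformDiluteLatticeBEC (target) — X of § Thesis — uniform ground-state BEC
(zero-mode occupation ≥ cN) of hard-core bosons on the even 3-D tori at ALL fillings ν ≤ ν₀, stated
for every sector ground vector (unit, in `spinZSector 1 (N − L³/2)`, eigenvalue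
`lowestEnergyInSector`). (why it might fail: it is (the dilute half of) LSSY's open 'BEC at other
fillings'; false only if dilute hard-core lattice bosons lose their condensate fraction as ν → 0 or
L → ∞ — contradicts Bogoliubov theory, the rigorous 4πaρ² law (arXiv:2602.16566) heuristics and
QMC.) [LSSY2005, AizenmanEtAl2004, KLS1988PRL, Toth1991, arXiv:2602.16566]
#2 FractionMonotone (crux) — (card conjecture M, pairwise/monotone form, d = 3) there is L₀ such
that on every even torus (ℤ/Lℤ)³, L ≥ L₀, for all 1 ≤ N ≤ N' ≤ L³/2 and all sector ground vectors ψ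
(sector N) and ψ' (sector N'): f_L(N') ≤ f_L(N), typed cross-multiplied ⟨ψ', S⁺_totS⁻_tot ψ'⟩·N ≤
⟨ψ, S⁺_totS⁻_tot ψ⟩·N' — adding hard-core bosons below half filling never raises the condensate
fraction. [difficulty: L] (why it might fail: no inequality comparing ground states of different
S³-sectors of the XY model is known (Tóth's upper bound is the only rigorous N-dependence);
level-ordering statements do fail at finite size (doi:10.1063/1.3699015) — hence ∃L₀ — and a
re-entrant f at intermediate ν would kill it.) [KLS1988PRL, Toth1991, LSSY2005,
doi:10.1007/BF01029210, doi:10.1103/PhysRevB.65.104519, doi:10.1103/physrevb.53.5826,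
doi:10.1023/b:joss.0000037227.24460.e5, doi:10.1063/1.3699015]
#3 DiluteLatticeBridge (crux) — X (uniform dilute BEC of hard-core bosons on the even 3-D tori)
implies PeriodicBEC(v) for every repulsive finite-range v: at all small ρ, for all large N, every
δ-near-minimiser of the periodic energy on the torus of side (N/ρ)^{1/3} has constant-mode
occupation ≥ cN (verbatim the hypothesis body of BoundaryTransferWeak). Intended mechanism (card
optical-lattice-depth-homotopy in its dilute–dilute regime, corrected spacing): for L = (N/ρ)^{1/3}
pick the even n with b = L/n ∈ [4R₀, 8R₀) and dial the depth c of Σ_i c·W(x_i/b); at FIXED (N, L)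
the deep end is the hard-core lattice gas in sector N on (ℤ/nℤ)³ at filling ν = ρb³ ≤ ν₀ (wells b ≥
4R₀ apart never interact; double occupancy costs U_c/t_c → ∞), condensed with fraction ≥ c by X;
a(v)/b ≤ 1/4 < 0.316 = a_latt/b makes the lattice end the MORE depleted one at leading order for
every v, and 'depth only depletes' (λ_max of γ non-increasing in c) carries the bound to c = 0,
where λ_max = constant-mode occupation. [deps: UniformDiluteLatticeBEC] [difficulty: open-problem]
(why it might fail: rests on an unproved sign — λ_max(γ) non-increasing in lattice depth (top mode
reshapes: Bloch/Wannier; Feynman–Kac weights monotone only un-normalised) — plus a fixed-(N,L)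
tight-binding limit; as a bare implication it is as hard as PeriodicBEC unless that sign is found.)
[AizenmanEtAl2004, LSSY2005, doi:10.1103/PhysRevLett.81.3108, arXiv:1202.3489,
doi:10.1103/physrevlett.96.180405, arXiv:2112.10301, arXiv:2602.16566, arXiv:1612.05758]
#4 BoundaryTransferWeak (crux) — (shared item stmt-AtomisticToContinuum-0827, verbatim) for each
repulsive finite-range v, PeriodicBEC(v) implies ∃ρ₀ > 0 ∀ρ ∈ (0, ρ₀), HasGroundStateBEC v ρ
(Dirichlet ground state, λ_max(γ) ≥ cN via condensateNumber). [deps: DiluteLatticeBridge]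
[difficulty: L] (why it might fail: PeriodicBEC(v) is ground-state-only at the box (N/ρ)^{1/3}: the
Dirichlet ground state is a periodic trial state but lies a wall term ≫ δ above E₀^per, and interior
restrictions are neither periodic nor of sharp N; BEC is boundary-condition sensitive (Robinson
1976).) [LSSY2005, doi:10.1007/bf01608554, arXiv:math-ph/0205037, arXiv:2603.20776,
arXiv:2205.15284, arXiv:2203.01841]
#9 AnchorSectorBEC (support) — (the KLS anchor in sector form; provable from the tree) there are c₁
> 0 and L₀ such that for every even L ≥ L₀ some sector N* with c₁L³ ≤ N* ≤ L³/2 has a sector ground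
vector ψ* with ⟨ψ*, S⁺_totS⁻_tot ψ*⟩ ≥ c₁·N*·L³. Proof route: `kennedy_lieb_shastry_xy_ground_holds
3 _ 1 _` unfolds (hasEvenTorusLRO_iff, torusPullback bijective on halfOpenBox) to Σ_{x,y}
groundStateXYCorrTorus L 1 x y ≥ c₀L⁶ for large even L; the tracial ground functional is the average
over an H- and S³_tot-adapted orthonormal basis of the ground space, so some unit ground vector ψ in
some sector M has planar moment ⟨(S¹_tot)²+(S²_tot)²⟩ ≥ c₀L⁶; the π-rotation about S¹ (commutes with
H) makes M ≤ 0; S⁺_totS⁻_tot = (S¹_tot)² + (S²_tot)² + S³_tot gives ⟨S⁺S⁻⟩ ≥ c₀L⁶ − L³/2, and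
Cauchy–Schwarz ⟨S⁺_totS⁻_tot⟩ ≤ L³·Σ_x⟨S⁺_xS⁻_x⟩ = L³·N* gives N* ≥ c₀L³ − 1/2; ground energy =
sector energy for a sector containing a ground vector. [difficulty: provable-now] [KLS1988PRL,
Tasaki2020, Literature.MathematicalPhysics.QuantumLattice.kennedy_lieb_shastry_xy_ground_holds]
#9 LatticeGlue (support) — FractionMonotone → AnchorSectorBEC → UniformDiluteLatticeBEC (crux first;
re-spelled in arrow form at rev 5 — the rev-1 curried-∀ spelling hid the conclusion from the
target-reachability check — same proposition up to the order of the two hypotheses): with ν₀ := c :=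
c₁ and L₀ := max of the two thresholds, for 1 ≤ N ≤ c₁L³ ≤ N* apply FractionMonotone to (N, N*, ψ,
ψ*), chain c₁N*L³·N ≤ ⟨S⁺S⁻⟩_{ψ*}·N ≤ ⟨S⁺S⁻⟩_ψ·N* and divide by N* > 0 (12 tactic lines of real
arithmetic; proved sorry-free as `latticeGlue_holds` in the planner's Sketch.lean, attached as
evidence on the item — transcribe it). [difficulty: provable-now] [KLS1988PRL, Toth1991]

TWO-LAYER PLAN. Foreseen glued splits (none filed now). FractionMonotone ⇐ FractionStepMonotone
(single step N → N+1: ⟨S⁺S⁻⟩_{N+1}·N ≤ ⟨S⁺S⁻⟩_N·(N+1) for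
2(N+1) ≤ L³) → telescoping glue (needs existence of sector ground vectors in every intermediate
sector: compactness + invariance, provable).
DiluteLatticeBridge ⇐ DepthOnlyDepletesDilute (λ_max of the depth-c ground state non-increasing in c
at fixed (N, L), b ∈ [4R₀, 8R₀), ν ≤ ν₀)
→ DeepLatticeLimitDilute (fixed-(N, L) tight-binding limit: liminf_c λ_max(c) ≥ n⁻³⟨S⁺_totS⁻_tot⟩_N
on (ℤ/nℤ)³ — where X enters) →
CommensurateModeGlue (choice of even n, λ_max = constant-mode occupation for translation-invariant
positive periodic ground states,
near-minimiser rigidity at fixed N) — k = 3, typed over the inline depth functional of the sibling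
line (optical-lattice-depth-homotopy) and
SHARED with its route when that is re-filed. AnchorSectorBEC's lemmas (sector-adapted ground basis,
π-rotation, Cauchy–Schwarz bound
⟨S⁺_totS⁻_tot⟩ ≤ L³N) ride as `--supports AnchorSectorBEC` helpers, never items.

KILL CRITERIA. A certified violation of FractionMonotone in d = 3 (sector ED / sign-free SSE or worm
QMC: some even L ≥ 6 and 1 ≤ N < N' ≤ L³/2 with
f_L(N') > f_L(N) beyond error bars, persisting at the next even size) closes the route
`refuted:FractionMonotone` by planner decision — the line IS this
inequality; as typed (∃L₀) a finite-size violation is not a Lean refutation of the item, and the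
refuters' suggested L₀-free single-step sibling — the computationally refutable form — is the
foreseen layer-2 child FractionStepMonotone (the concavity variant C of the card would be the only
pivot, as a new route). A QMC-certified RISE of λ_max(γ) with lattice depth
at b ∈ [4R₀, 8R₀) and ν ≤ ν₀ refutes only the intended mechanism of DiluteLatticeBridge (pivot: hand
X to the half-filling depth route as its
commensurability glue, or bridge through a different regularisation). PeriodicBEC or the conjunct
proved elsewhere moots ranks 3–4 but not X;
X proved by any method closes ranks 0/2 and the supports as moot-by-success.

NOT DECOMPOSED YET. Constants ν₀ = c = c₁ ≈ (KLS constant)/2 and L₀; the card's d = 2 and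
all-fillings (ν ≤ 1/2) generality — the conjunct needs only d = 3 and
ν ≤ ν₀, and the stronger endpoint/moment statements of gen-1 (FractionDominatesHalfFilling,
HalfFillingMaximisesMoment) are deliberately NOT
re-filed; the concavity variant C; the positive-temperature random-loop version (card item L,
cosh(βμ|ℓ|/2)-tilted loop measure, d ≥ 3) —
a different thesis; the sector-projector kernel 'P_M is RP iff M = 0' (negative-side lemma for the
barrier file, not load-bearing); every
layer-2 child of the bridge (depth functional Λ_{N,L}(c), tight-binding limit, mode identification),
which waits for the sibling
card's re-filed route so the items can be shared rather than typed twice.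

CHEAPEST FALSIFIER. Sector-resolved matrix-free Lanczos ED of hard-core bosons on (ℤ/4ℤ)³ (N = 1…5,
ν ≤ 0.078) and (ℤ/6ℤ)³ (N = 1…3), tabulating
f_L(N) = ⟨S⁺_totS⁻_tot⟩_N/(N·L³) and testing the single-step inequality f_L(N+1) ≤ f_L(N) exactly in
the dilute corner the route uses —
submitted from this seat as kit jobs j004502 (L = 4) and j004503 (L = 6) with `--workitem
stmt-AtomisticToContinuum-13630` (= FractionMonotone
after the rrepair-g1 restatement; script ed_fraction.py in the planner folder; f_L(1) = 1 exactly is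
the built-in check); the runner attaches the logs to
FractionMonotone as evidence when they end (FractionMonotone is stmt-AtomisticToContinuum-13878
since rev 4, same proposition; evidence on the predecessors 13057/13630 transfers by Iff.rfl).
Evidence so far (refuter passes): exact sector ground states give f_2(N) = 1, 0.854, 0.723, 0.594 (N
= 1…4, Tóth's bound 1 − ν + 1/V respected) and f_4(N) = 1, 0.9796, 0.9597 (N = 1…3), strictly
decreasing; the crux-attack on 13630 SURVIVES (sector ED on even tori at small N, 0 violations;
GP-regime Bogoliubov necessary condition consistent). Next: sign-free SSE/worm QMC on 8³–16³ for
f(ν)/f(ν') across ν ≤ 1/2, and λ_max versus lattice depth at b = 4R₀, ν = 1/64 (the bridge sign).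
Literature proxies checked: QMC curves
ρ₀(n) of doi:10.1103/PhysRevB.65.104519 (2-D) and doi:10.1103/physrevb.53.5826 (3-D) are concave
with maximum at n = 1/2; Bogoliubov
'potential depletion' of a weak lattice is ≥ 0 in d = 3 (arXiv:1202.3489 §4.2).

NUMBERS. Rigorous: Toth1991 λ_max(γ_N) ≤ N(V−N+1)/V, i.e. f_L(N) ≤ 1 − ν + 1/V (one-sided,
consistent with M); complete graph f = 1 − (N−1)/V
exactly (M holds with equality structure); KLS/LSSY2005 (11.26) at λ = 0, β → ∞, d = 3:
V⁻²⟨(S¹_tot)²+(S²_tot)²⟩ ≥ 1/2 − (1/2)(√3·0.5055)^{1/2}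
≈ 0.032, so c₁ ≈ 0.03 and the transported fraction is f ≥ 0.03 at every ν ≤ 0.03 (true values ≈
0.97–1). Hard-core lattice scattering
length a_latt = 0.316(2) b (QMC, arXiv:2112.10301) = b/(8πγ), γ = 0.1264 (arXiv:2602.16566 (2.12), U
→ ∞); bridge spacing b ∈ [4R₀, 8R₀)
⇒ a(v)/b ≤ 1/4; leading depletions at filling ν: continuum 1.505(ν(a/b)³)^{1/2} ≤ 0.19ν^{1/2} versus
lattice ν + 1.505(ν·0.0316)^{1/2} ≈ ν + 0.27ν^{1/2}.
Density window of the conjunct delivered: ρ < ν₀/(8R₀)³. Items at open: 7 (1 target, 3 cruxes, 2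
support, 1 assembly).

DEFINITION REQUESTS. None. Sector ground vectors are typed over existing `spinZSector`,
`lowestEnergyInSector`, `xyTorus`, `totalSpin` (all statements rc 0 in
Sketch.lean); the bridge's layer-2 children will need the one-body-potential energy functional of
the sibling line (its request, not duplicated).

Novelty: Searches (2026-08-15, this seat): zbMATH 'hard-core bosons condensate fraction filling monotone
sector comparison' (0), 'ordering of energy
levels XXZ' (3: NSS 2004 doi:10.1023/b:joss.0000037227.24460.e5, Nachtergaele–Starr
arXiv:math-ph/0408020, Nachtergaele–Ng–Starr arXiv:1105.5264 —
energies, SU(2)/U_q(sl₂), not order parameters, not XY); arXiv 'scattering length Bose-Hubbard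
hard-core lattice dilute' (2: arXiv:2112.10301
a_latt = 0.316 b, arXiv:2501.14887); crossref 'Observation of strong quantum depletion…' (5:
doi:10.1103/physrevlett.96.180405, doi:10.1088/1367-2630/14/7/075025
= arXiv:1202.3489 potential depletion ≥ 0 in d = 3); `lit galaxy search --star all` substring (0)
and `--star pdf --mode bm25` 'ground state of the
spin-1/2 XY model lies in the zero magnetization sector; energy of hard-core bosons vs particle
number; condensate fraction versus filling' (15,
none rigorous/relevant); lean search (spinZSector, lowestEnergyInSector,
kennedy_lieb_shastry_xy_ground_holds, LiebMattisSectorPF); local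
searchd/hybrid index rc 75 (off-box service unavailable at filing — recorded, not worked around);
inherited: the card's five novelty audits
(zbMATH/Crossref legs, Toth1991 / Penrose 1991 complete-graph exactness, QMC 2-D/3-D) and gen-1's
searches.
Nearest prior art found: KLS1988PRL (the anchor, in tree) and LSSY2005 Ch. 11 §11.1 (states the
all-fillings expectation, no schema);
Toth1991 (the only rigorous N-dependence, one-sided); doi:10.1023/b:joss.0000037227.24460.e5 (or  [refs: 10.1023/b:joss.0000037227.24460.e5, 10.1103/physrevlett.96.180405, 10.1088/1367-2630/14/7/075025, math-ph/0408020, 1105.5264, 2112.10301, 2501.14887, 1202.3489, doi:10.1023/b, doi:10.1103/physrevlett.96.180405, doi:10.1088/1367-2630/14/7/075025, Toth1991, LSSY2005]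

Barriers (technique_class: sector-comparison filling-monotone RP-anchor depth-dial): - technique_class: sector-comparison filling-monotone RP-anchor depth-dial
- Literature.Barriers.AtomisticToContinuum.HalfFillingReflectionPositivity: used as the ANCHOR only
(KLS at the symmetric point, a theorem of the tree, inside the entry's scope); the extension in the
filling is a comparison between sector ground states invoking no reflection, hence outside the
RP/Gaussian-domination class — honest: no tool for the comparison exists yet; the bet is
Perron–Frobenius positivity of the sector ground states of one stoquastic Hamiltonian.
- Literature.Barriers.AtomisticToContinuum.HalfFillingReflectionPositivityNarrow: its
`rp_oddCharge_eq_zero` (an RP state has ⟨N⟩ = |Λ|/2) is exactly why doped sectors are reached by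
order, never by RP; nothing RP is asserted off half filling.
- Literature.Barriers.AtomisticToContinuum.SymmetryBreakingWithoutCondensate: not met — canonical
sectors, zero source field; the order parameter ⟨S⁺_totS⁻_tot⟩ = L³·N₀ of the particle-conserving
ground state is the condensate itself.
- Literature.Barriers.AtomisticToContinuum.HohenbergLowDimension: consistent — T = 0 throughout, d =
3; the card's thermal loop version is not filed.
- Literature.Barriers.AtomisticToContinuum.PitaevskiiStringariOneDimension: consistent — items are d
= 3 only; in d = 1 the anchor fails and nothing is inferred.
- Literature.Barriers.AtomisticToContinuum.OneDimensionalHardCore: same — the Girardeau/Lenard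
witness lives in d = 1, outside every item.
- Literature.Barriers.At

History (route lifecycle, newest last):
- 2026-08-15T19:49:40Z · rev 1: restated UniformDiluteLatticeBEC (stmt-AtomisticToContinuum-13056), FractionMonotone (stmt-AtomisticToContinuum-13057), AnchorSectorBEC (stmt-AtomisticToContinuum-13059), LatticeGlue (stmt-AtomisticToContinuum-13060) — cone repair (rrepair g1): (i) the 4 unproved named facts in the import cone were the four `[ci (planner-rrepair-AtomisticToContinuum-BECFillin-16c5aa21-0)
- 2026-08-15T19:58:23Z · rev 3: restated UniformDiluteLatticeBEC (stmt-AtomisticToContinuum-13629), FractionMonotone (stmt-AtomisticToContinuum-13630) — docstring hygiene after rev 1: the RESTATED notes of UniformDiluteLatticeBEC/FractionMonotone quoted the literal tag text `[cite…` of the Mermin–Wagner facts, w (planner-rrepair-AtomisticToContinuum-BECFillin-16c5aa21-0)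
- 2026-08-16T03:03:37Z · rev 5: restated LatticeGlue (stmt-AtomisticToContinuum-13632) — rbadge (A11 stamp route.target-unreachable): LatticeGlue re-spelled from the rev-1 curried form `∀ (_ : AnchorSectorBEC) (_ : FractionMonotone), UniformDiluteLa (planner-rbadge-AtomisticToContinuum-BECFilling-16c5aa21-0)
- 2026-08-25T00:35:21Z · DORMANT — reconciler: no traction for 7.2 d (last activity item-evidence-added at 2026-08-17T18:55:01Z); parked, not closed — `ledger route dormant route-AtomisticToConti (operator:999:272462)
- 2026-08-29T03:18:18Z · REACTIVATED — reconciler: reactivated — activity statement-checked at 2026-08-29T01:17:37Z after parking at 2026-08-25T00:35:21Z (operator:999:3695201)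

sub-problem: BoseEinsteinCondensation · status: open · opened planner-plancard-AtomisticToContinuum-BoseEin-88822eff-g2-0 2026-08-15T18:57:12Z · rev 6 · ledger route-AtomisticToContinuum-BECFillingDescent
GENERATED by the gate from the ledger (D-0016/17). Provers cite these decls: `theorem foo : Summit.AtomisticToContinuum.BoseEinsteinCondensation.Theses.BECFillingDescent.<Decl> := …` in Summits/AtomisticToContinuum/BoseEinsteinCondensation/Theorems/<Name>.lean.
-/

namespace Summit.AtomisticToContinuum.BoseEinsteinCondensation.Theses.BECFillingDescent

open scoped BigOperators Topology Manifold Classical MeasureTheory ProbabilityTheory Matrix InnerProductSpace ComplexConjugate ContinuousMap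
open Filter Set Function TopologicalSpace MeasureTheory

attribute [summit_statement] _root_.BoseEinsteinCondensation

-- earlier UniformDiluteLatticeBEC (stmt-AtomisticToContinuum-13056, replaced 2026-08-15T19:49:40Z -> stmt-AtomisticToContinuum-13629): retired by None — ∃ ν₀ : ℝ, 0 < ν₀ ∧ ∃ c : ℝ, 0 < c ∧ ∃ L₀ : ℕ, ∀ (L : ℕ) [NeZero L], L₀ ≤ L → Even L → ∀ N : ℕ, 1 ≤ N → (N : ℝ) ≤ ν₀ * (L : ℝ) ^ 3 → ∀ ψ : Literature.MathematicalPhysics.QuantumLattice.TensorIndex (Literature.Probability.LatticeModels.TorusSite 3 L) 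
-- earlier UniformDiluteLatticeBEC (stmt-AtomisticToContinuum-13629, replaced 2026-08-15T19:58:23Z -> stmt-AtomisticToContinuum-13720): retired by None — ∃ ν₀ : ℝ, 0 < ν₀ ∧ ∃ c : ℝ, 0 < c ∧ ∃ L₀ : ℕ, ∀ (L : ℕ) [NeZero L], L₀ ≤ L → Even L → ∀ N : ℕ, 1 ≤ N → (N : ℝ) ≤ ν₀ * (L : ℝ) ^ 3 → ∀ ψ : Literature.MathematicalPhysics.QuantumLattice.TensorIndex (Literature.Probability.LatticeModels.TorusSite 3 L) 
/-- item stmt-AtomisticToContinuum-13877 · target · rank 0 · open · by planner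
why it might fail: it is (the dilute half of) LSSY's open 'BEC at other fillings'; false only if dilute hard-core lattice bosons lose their condensate fraction as ν → 0 or L → ∞ — contradicts Bogoliubov theory, the rigorous 4πaρ² law (arXiv:2602.16566) heuristics and QMC.
sources: LSSY2005, AizenmanEtAl2004, KLS1988PRL, Toth1991, arXiv:2602.16566
X of § Thesis — uniform ground-state BEC (zero-mode occupation ≥ cN) of hard-core bosons on the even
3-D tori at ALL fillings ν ≤ ν₀, stated for every sector ground vector (unit, in `spinZSector 1 (N −
L³/2)`, eigenvalue `lowestEnergyInSector`). RESTATED 2026-08-15 (cone repair, rrepair g1): same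
proposition as stmt-AtomisticToContinuum-13056 (via 13629) — the abbrev `xyTorus 3 L 1` is unfolded
to its body `xxzHamiltonian 1 (torusGraph 3 L) (-1) 0` and the ℕ→ℝ casts of N are written explicitly
(rfl-equal terms; planner DefEqCheck.lean / DefEqCheck2.lean), so that the route file imports
HeisenbergModel + LatticeGraph instead of XYOrder → HeisenbergOrder, whose four unproved
Mermin–Wagner facts were the only unproved constants of the import cone. -/
@[route_item "route-AtomisticToContinuum-BECFillingDescent"]
def UniformDiluteLatticeBEC : Prop :=
  ∃ ν₀ : ℝ, 0 < ν₀ ∧ ∃ c : ℝ, 0 < c ∧ ∃ L₀ : ℕ, ∀ (L : ℕ) [NeZero L], L₀ ≤ L → Even L → ∀ N : ℕ, 1 ≤ N → (N : ℝ) ≤ ν₀ * (L : ℝ) ^ 3 → ∀ ψ : Literature.MathematicalPhysics.QuantumLattice.TensorIndex (Literature.Probability.LatticeModels.TorusSite 3 L) 2 → ℂ, ψ ∈ Literature.MathematicalPhysics.QuantumLattice.spinZSector (Λ := Literature.Probability.LatticeModels.TorusSite 3 L) 1 ((N : ℝ) - (L : ℝ) ^ 3 / 2) → star ψ ⬝ᵥ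 ψ = 1 → (Literature.MathematicalPhysics.QuantumLattice.xxzHamiltonian 1 (Literature.Probability.LatticeModels.torusGraph 3 L) (-1) 0) *ᵥ ψ = ((Literature.MathematicalPhysics.QuantumLattice.lowestEnergyInSector 1 (Literature.MathematicalPhysics.QuantumLattice.xxzHamiltonian 1 (Literature.Probability.LatticeModels.torusGraph 3 L) (-1) 0) ((N : ℝ) - (L : ℝ) ^ 3 / 2) : ℝ) : ℂ) • ψ → c * (N : ℝ) * (L : ℝ) ^ 3 ≤ (star ψ ⬝ᵥ (((Literature.MathematicalPhysics.QuantumLattice.totalSpin 1 0 + Complex.I • Literature.MathematicalPhysics.QuantumLattice.totalSpin 1 1) * (Literature.MathematicalPhysics.QuantumLattice.totalSpin 1 0 - Complex.I • Literature.MathematicalPhysics.QuantumLattice.totalSpin 1 1)) *ᵥ ψ)).re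

-- earlier FractionMonotone (stmt-AtomisticToContinuum-13057, replaced 2026-08-15T19:49:40Z -> stmt-AtomisticToContinuum-13630): retired by None — ∃ L₀ : ℕ, ∀ (L : ℕ) [NeZero L], L₀ ≤ L → Even L → ∀ N N' : ℕ, 1 ≤ N → N ≤ N' → 2 * N' ≤ L ^ 3 → ∀ ψ ψ' : Literature.MathematicalPhysics.QuantumLattice.TensorIndex (Literature.Probability.LatticeModels.TorusSite 3 L) 2 → ℂ, ψ ∈ Literature.MathematicalPhysic
-- earlier FractionMonotone (stmt-AtomisticToContinuum-13630, replaced 2026-08-15T19:58:23Z -> stmt-AtomisticToContinuum-13721): retired by None — ∃ L₀ : ℕ, ∀ (L : ℕ) [NeZero L], L₀ ≤ L → Even L → ∀ N N' : ℕ, 1 ≤ N → N ≤ N' → 2 * N' ≤ L ^ 3 → ∀ ψ ψ' : Literature.MathematicalPhysics.QuantumLattice.TensorIndex (Literature.Probability.LatticeModels.TorusSite 3 L) 2 → ℂ, ψ ∈ Literature.MathematicalPhysic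
/-- item stmt-AtomisticToContinuum-13878 · crux · rank 2 · open · by planner
why it might fail: no inequality comparing ground states of different S³-sectors of the XY model is known (Tóth's upper bound is the only rigorous N-dependence); level-ordering statements do fail at finite size (doi:10.1063/1.3699015) — hence ∃L₀ — and a re-entrant f at intermediate ν would kill it.
sources: KLS1988PRL, Toth1991, LSSY2005, doi:10.1007/BF01029210, doi:10.1103/PhysRevB.65.104519, doi:10.1103/physrevb.53.5826
(card conjecture M, pairwise/monotone form, d = 3) there is L₀ such that on every even torus
(ℤ/Lℤ)³, L ≥ L₀, for all 1 ≤ N ≤ N' ≤ L³/2 and all sector ground vectors ψ (sector N) and ψ' (sector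
N'): f_L(N') ≤ f_L(N), typed cross-multiplied ⟨ψ', S⁺_totS⁻_tot ψ'⟩·N ≤ ⟨ψ, S⁺_totS⁻_tot ψ⟩·N' —
adding hard-core bosons below half filling never raises the condensate fraction. [difficulty: L]
RESTATED 2026-08-15 (cone repair, rrepair g1): same proposition as stmt-AtomisticToContinuum-13057
(via 13630) — the abbrev `xyTorus 3 L 1` is unfolded to its body `xxzHamiltonian 1 (torusGraph 3 L)
(-1) 0` and the ℕ→ℝ casts of N, N' are written explicitly (rfl-equal terms; planner DefEqCheck.lean
/ DefEqCheck2.lean), so that the route file imports HeisenbergModel + LatticeGraph instead of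
XYOrder → HeisenbergOrder, whose four unproved Mermin–Wagner facts were the only unproved constants
of the import cone. -/
@[route_item "route-AtomisticToContinuum-BECFillingDescent", crux]
def FractionMonotone : Prop :=
  ∃ L₀ : ℕ, ∀ (L : ℕ) [NeZero L], L₀ ≤ L → Even L → ∀ N N' : ℕ, 1 ≤ N → N ≤ N' → 2 * N' ≤ L ^ 3 → ∀ ψ ψ' : Literature.MathematicalPhysics.QuantumLattice.TensorIndex (Literature.Probability.LatticeModels.TorusSite 3 L) 2 → ℂ, ψ ∈ Literature.MathematicalPhysics.QuantumLattice.spinZSector (Λ := Literature.Probability.LatticeModels.TorusSite 3 L) 1 ((N : ℝ) - (L : ℝ) ^ 3 / 2) → star ψ ⬝ᵥ ψ = 1 → (Literature.MathematicalPhysics.QuantumLattice.xxzHamiltonian 1 (Literature.Probability.LatticeModels.torusGraph 3 L) (-1) 0) *ᵥ ψ = ((Literature.MathematicalPhysics.QuantumLattice.lowestEnergyInSector 1 (Literature.MathematicalPhysics.QuantumLattice.xxzHamiltonian 1 (Literature.Probability.LatticeModels.torusGraph 3 L) (-1) 0) ((N : ℝ) - (L : ℝ) ^ 3 / 2) : ℝ)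 : ℂ) • ψ → ψ' ∈ Literature.MathematicalPhysics.QuantumLattice.spinZSector (Λ := Literature.Probability.LatticeModels.TorusSite 3 L) 1 ((N' : ℝ) - (L : ℝ) ^ 3 / 2) → star ψ' ⬝ᵥ ψ' = 1 → (Literature.MathematicalPhysics.QuantumLattice.xxzHamiltonian 1 (Literature.Probability.LatticeModels.torusGraph 3 L) (-1) 0) *ᵥ ψ' = ((Literature.MathematicalPhysics.QuantumLattice.lowestEnergyInSector 1 (Literature.MathematicalPhysics.QuantumLattice.xxzHamiltonian 1 (Literature.Probability.LatticeModels.torusGraph 3 L) (-1) 0) ((N' : ℝ) - (L : ℝ) ^ 3 / 2) : ℝ) : ℂ) • ψ' → (star ψ' ⬝ᵥ (((Literature.MathematicalPhysics.QuantumLattice.totalSpin 1 0 + Complex.I • Literature.MathematicalPhysics.QuantumLattice.totalSpin 1 1) * (Literature.MathematicalPhysics.QuantumLattice.totalSpin 1 0 - Complex.I • Literature.MathematicalPhysics.QuantumLattice.totalSpin 1 1)) *ᵥ ψ')).re * (N : ℝ) ≤ (star ψ ⬝ᵥ (((Literature.MathematicalPhysics.QuantumLattice.totalSpin 1 0 +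 Complex.I • Literature.MathematicalPhysics.QuantumLattice.totalSpin 1 1) * (Literature.MathematicalPhysics.QuantumLattice.totalSpin 1 0 - Complex.I • Literature.MathematicalPhysics.QuantumLattice.totalSpin 1 1)) *ᵥ ψ)).re * (N' : ℝ)

/-- item stmt-AtomisticToContinuum-13058 · crux · rank 3 · open · by planner
why it might fail: rests on an unproved sign — λ_max(γ) non-increasing in lattice depth (top mode reshapes: Bloch/Wannier; Feynman–Kac weights monotone only un-normalised) — plus a fixed-(N,L) tight-binding limit; as a bare implication it is as hard as PeriodicBEC unless that sign is found.
sources: AizenmanEtAl2004, LSSY2005, doi:10.1103/PhysRevLett.81.3108, arXiv:1202.3489, doi:10.1103/physrevlett.96.180405, arXiv:2112.10301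
[crux] X (uniform dilute BEC of hard-core bosons on the even 3-D tori) implies PeriodicBEC(v) for
every repulsive finite-range v: at all small ρ, for all large N, every δ-near-minimiser of the
periodic energy on the torus of side (N/ρ)^{1/3} has constant-mode occupation ≥ cN (verbatim the
hypothesis body of BoundaryTransferWeak). Intended mechanism (card optical-lattice-depth-homotopy in
its dilute–dilute regime, corrected spacing): for L = (N/ρ)^{1/3} pick the even n with b = L/n ∈
[4R₀, 8R₀) and dial the depth c of Σ_i c·W(x_i/b); at FIXED (N, L) the deep end is the hard-core
lattice gas in sector N on (ℤ/nℤ)³ at filling ν = ρb³ ≤ ν₀ (wells b ≥ 4R₀ apart never interact;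
double occupancy costs U_c/t_c → ∞), condensed with fraction ≥ c by X; a(v)/b ≤ 1/4 < 0.316 =
a_latt/b makes the lattice end the MORE depleted one at leading order for every v, and 'depth only
depletes' (λ_max of γ non-increasing in c) carries the bound to c = 0, where λ_max = constant-mode
occupation. [deps: UniformDiluteLatticeBEC] [difficulty: open-problem] -/
@[route_item "route-AtomisticToContinuum-BECFillingDescent", crux]
def DiluteLatticeBridge : Prop :=
  UniformDiluteLatticeBEC → ∀ v : ℝ → ENNReal, Literature.MathematicalPhysics.QuantumManyBody.BoseGas.IsRepulsiveFiniteRange v → ∃ ρ₀ : ℝ, 0 < ρ₀ ∧ ∀ ρ : ℝ, 0 < ρ → ρ < ρ₀ → ∃ c : ℝ, 0 < c ∧ ∀ᶠ N : ℕ in Filter.atTop, ∃ δ : ENNReal, 0 < δ ∧ ∀ Ψ : Literature.MathematicalPhysics.QuantumManyBody.BoseGas.PeriodicTrialState N (Literature.MathematicalPhysics.QuantumManyBody.BoseGas.sideLength ρ N), Literature.MathematicalPhysics.QuantumManyBody.BoseGas.periodicEnergy v Ψ ≤ Literature.MathematicalPhysics.QuantumManyBody.BoseGas.periodicGroundStateEnergy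 v N (Literature.MathematicalPhysics.QuantumManyBody.BoseGas.sideLength ρ N) + δ → ENNReal.ofReal (c * N) ≤ Literature.MathematicalPhysics.QuantumManyBody.BoseGas.condensateOccupation N (Literature.MathematicalPhysics.QuantumManyBody.BoseGas.sideLength ρ N) Ψ.ψ

/-- item stmt-AtomisticToContinuum-0827 · crux · rank 4 · open · by planner
why it might fail: PeriodicBEC(v) is ground-state-only at the box (N/ρ)^{1/3}: the Dirichlet ground state is a periodic trial state but lies a wall term ≫ δ above E₀^per, and interior restrictions are neither periodic nor of sharp N; BEC is boundary-condition sensitive (Robinson 1976).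
sources: LSSY2005, doi:10.1007/bf01608554, arXiv:math-ph/0205037, arXiv:2603.20776, arXiv:2205.15284, arXiv:2203.01841
[crux] BoundaryTransferWeak (mode-free boundary-condition transfer, per potential): for each
repulsive finite-range v, PeriodicBEC(v) implies ∃ρ₀>0 ∀ρ∈(0,ρ₀) HasGroundStateBEC v ρ (Dirichlet
ground state, λ_max(γ) ≥ cN via condensateNumber). Not glue: near-minimiser slacks are O(N/L²) while
Dirichlet/periodic energies differ by a boundary term ≫ N/L², so no energy-comparison proof;
expected route: Neumann bracketing of interior sub-boxes (−Δ_Dir ≥ ⊕−Δ_Neu, v ≥ 0) + a mode-free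
criterion (λ_max ≥ tr γ²/N). Only the ENERGY analogue is in print (LiebSeiringerSolovejYngvason2005
Ch. 2 after (2.8)). v ≡ 0: hypothesis and conclusion both true. -/
@[route_item "route-AtomisticToContinuum-BECFillingDescent", crux]
def BoundaryTransferWeak : Prop :=
  ∀ v : ℝ → ENNReal, Literature.MathematicalPhysics.QuantumManyBody.BoseGas.IsRepulsiveFiniteRange v → (∃ ρ₀ : ℝ, 0 < ρ₀ ∧ ∀ ρ : ℝ, 0 < ρ → ρ < ρ₀ → ∃ c : ℝ, 0 < c ∧ ∀ᶠ N : ℕ in Filter.atTop, ∃ δ : ENNReal, 0 < δ ∧ ∀ Ψ : Literature.MathematicalPhysics.QuantumManyBody.BoseGas.PeriodicTrialState N (Literature.MathematicalPhysics.QuantumManyBody.BoseGas.sideLength ρ N), Literature.MathematicalPhysics.QuantumManyBody.BoseGas.periodicEnergy v Ψ ≤ Literature.MathematicalPhysics.QuantumManyBody.BoseGas.periodicGroundStateEnergy v N (Literature.MathematicalPhysics.QuantumManyBody.BoseGas.sideLength ρ N) + δ → ENNReal.ofReal (c * N) ≤ Literature.MathematicalPhysics.QuantumManyBody.BoseGas.condensateOccupation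 N (Literature.MathematicalPhysics.QuantumManyBody.BoseGas.sideLength ρ N) Ψ.ψ) → ∃ ρ₀ : ℝ, 0 < ρ₀ ∧ ∀ ρ : ℝ, 0 < ρ → ρ < ρ₀ → Literature.MathematicalPhysics.QuantumManyBody.BoseGas.HasGroundStateBEC v ρ

-- earlier AnchorSectorBEC (stmt-AtomisticToContinuum-13059, replaced 2026-08-15T19:49:40Z -> stmt-AtomisticToContinuum-13631): retired by None — ∃ c₁ : ℝ, 0 < c₁ ∧ ∃ L₀ : ℕ, ∀ (L : ℕ) [NeZero L], L₀ ≤ L → Even L → ∃ N : ℕ, c₁ * (L : ℝ) ^ 3 ≤ N ∧ 2 * N ≤ L ^ 3 ∧ ∃ ψ : Literature.MathematicalPhysics.QuantumLattice.TensorIndex (Literature.Probability.LatticeModels.TorusSite 3 L) 2 → ℂ, ψ ∈ Literature.M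
/-- item stmt-AtomisticToContinuum-13631 · support · rank 9 · open · by planner
sources: KLS1988PRL, Tasaki2020, Literature.MathematicalPhysics.QuantumLattice.kennedy_lieb_shastry_xy_ground_holds
[support] (the KLS anchor in sector form; provable from the tree) there are c₁ > 0 and L₀ such that
for every even L ≥ L₀ some sector N* with c₁L³ ≤ N* ≤ L³/2 has a sector ground vector ψ* with ⟨ψ*,
S⁺_totS⁻_tot ψ*⟩ ≥ c₁·N*·L³. Proof route: `kennedy_lieb_shastry_xy_ground_holds 3 _ 1 _` unfolds
(hasEvenTorusLRO_iff, torusPullback bijective on halfOpenBox) to Σ_{x,y} groundStateXYCorrTorus L 1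
x y ≥ c₀L⁶ for large even L; the tracial ground functional is the average over an H- and
S³_tot-adapted orthonormal basis of the ground space, so some unit ground vector ψ in some sector M
has planar moment ⟨(S¹_tot)²+(S²_tot)²⟩ ≥ c₀L⁶; the π-rotation about S¹ (commutes with H) makes M ≤
0; S⁺_totS⁻_tot = (S¹_tot)² + (S²_tot)² + S³_tot gives ⟨S⁺S⁻⟩ ≥ c₀L⁶ − L³/2, and Cauchy–Schwarz
⟨S⁺_totS⁻_tot⟩ ≤ L³·Σ_x⟨S⁺_xS⁻_x⟩ = L³·N* gives N* ≥ c₀L³ − 1/2; ground energy = sector energy for a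
sector containing a ground vector. [difficulty: provable-now] RESTATED 2026-08-15 (cone repair,
rrepair g1): same proposition as stmt-AtomisticToContinuum-13059 with the abbrev `xyTorus 3 L 1`
unfolded to its body `xxzHamiltonian 1 (torusGraph 3 L) (-1) 0` (rfl-equal), so the route file
imports HeisenbergModel + Latt -/
@[route_item "route-AtomisticToContinuum-BECFillingDescent", crux]
def AnchorSectorBEC : Prop :=
  ∃ c₁ : ℝ, 0 < c₁ ∧ ∃ L₀ : ℕ, ∀ (L : ℕ) [NeZero L], L₀ ≤ L → Even L → ∃ N : ℕ, c₁ * (L : ℝ) ^ 3 ≤ N ∧ 2 * N ≤ L ^ 3 ∧ ∃ ψ : Literature.MathematicalPhysics.QuantumLattice.TensorIndex (Literature.Probability.LatticeModels.TorusSite 3 L) 2 → ℂ, ψ ∈ Literature.MathematicalPhysics.QuantumLattice.spinZSector (Λ := Literature.Probability.LatticeModels.TorusSite 3 L) 1 ((N : ℝ) - (L : ℝ) ^ 3 / 2) ∧ star ψ ⬝ᵥ ψ = 1 ∧ (Literature.MathematicalPhysics.QuantumLattice.xxzHamiltonian 1 (Literature.Probability.LatticeModels.torusGraph 3 L) (-1)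 0) *ᵥ ψ = ((Literature.MathematicalPhysics.QuantumLattice.lowestEnergyInSector 1 (Literature.MathematicalPhysics.QuantumLattice.xxzHamiltonian 1 (Literature.Probability.LatticeModels.torusGraph 3 L) (-1) 0) ((N : ℝ) - (L : ℝ) ^ 3 / 2) : ℝ) : ℂ) • ψ ∧ c₁ * N * (L : ℝ) ^ 3 ≤ (star ψ ⬝ᵥ (((Literature.MathematicalPhysics.QuantumLattice.totalSpin 1 0 + Complex.I • Literature.MathematicalPhysics.QuantumLattice.totalSpin 1 1) * (Literature.MathematicalPhysics.QuantumLattice.totalSpin 1 0 - Complex.I • Literature.MathematicalPhysics.QuantumLattice.totalSpin 1 1)) *ᵥ ψ)).re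

-- earlier LatticeGlue (stmt-AtomisticToContinuum-13060, replaced 2026-08-15T19:49:40Z -> stmt-AtomisticToContinuum-13632): retired by None — AnchorSectorBEC → FractionMonotone → UniformDiluteLatticeBEC
-- earlier LatticeGlue (stmt-AtomisticToContinuum-13632, replaced 2026-08-16T03:03:37Z -> stmt-AtomisticToContinuum-14120): retired by None — ∀ (_ : AnchorSectorBEC) (_ : FractionMonotone), UniformDiluteLatticeBEC
/-- item stmt-AtomisticToContinuum-14120 · support · rank 9 · open · by planner
sources: KLS1988PRL, Toth1991
[support] the glue of the lattice half, crux first: FractionMonotone → AnchorSectorBEC →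
UniformDiluteLatticeBEC. With ν₀ := c := c₁ (the anchor constant) and L₀ := max of the two
thresholds: for 1 ≤ N ≤ c₁L³ ≤ N* apply FractionMonotone to (N, N*, ψ, ψ*), chain c₁·N*·L³·N ≤ ⟨ψ*,
S⁺_totS⁻_tot ψ*⟩·N ≤ ⟨ψ, S⁺_totS⁻_tot ψ⟩·N* and divide by N* > 0. PROVED sorry-free as
`latticeGlue_holds` (12 tactic lines, lean check rc 0, no axioms beyond the whitelist) in this
planner's Sketch.lean, attached to the item as evidence — provable now by transcription into
Theorems/. RE-SPELLED 2026-08-16 (rbadge, A11 stamp route.target-unreachable): the rev-1 curried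
spelling `∀ (_ : AnchorSectorBEC) (_ : FractionMonotone), UniformDiluteLatticeBEC` hid the item's
conclusion from the target-reachability check; the arrow form with the crux first is the same
proposition up to the order of the two hypotheses, is a fresh signature (no collision with the
retired stmt-AtomisticToContinuum-13060) and renders after AnchorSectorBEC (rank 9, earlier
position). [deps: FractionMonotone, AnchorSectorBEC] [difficulty: provable-now] -/
@[route_item "route-AtomisticToContinuum-BECFillingDescent", crux]
def LatticeGlue : Prop :=
  FractionMonotone → AnchorSectorBEC → UniformDiluteLatticeBEC

/-- item stmt-AtomisticToContinuum-13061 · assembly · rank 1 · open · by planner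
sources: KLS1988PRL, LSSY2005
[assembly] AnchorSectorBEC → FractionMonotone → LatticeGlue → DiluteLatticeBridge →
BoundaryTransferWeak → the sub-problem statement. -/
@[route_item "route-AtomisticToContinuum-BECFillingDescent"]
def Assembly : Prop :=
  AnchorSectorBEC → FractionMonotone → LatticeGlue → DiluteLatticeBridge → BoundaryTransferWeak → BoseEinsteinCondensation

/-! D-0027 §2.1 — DECIDING THEOREM (planner-authored via `route open/edit --closes-file`; by planner-rbadge-AtomisticToContinuum-BECFilling-16c5aa21-0 2026-08-16T03:03:37Z):
its hypotheses are this route's items and its conclusion the sub-problem Statement (glue_lint), and it elaborates with this file. -/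

@[closes "route-AtomisticToContinuum-BECFillingDescent"] theorem closes (hA : AnchorSectorBEC) (hM : FractionMonotone) (hG : LatticeGlue) (hB : DiluteLatticeBridge) (hT : BoundaryTransferWeak) : BoseEinsteinCondensation :=
  fun v hv => hT v hv (hB (hG hM hA) v hv)

end Summit.AtomisticToContinuum.BoseEinsteinCondensation.Theses.BECFillingDescent
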